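import Literature.Computability.Complexity.SpaceLoop
import Literature.Computability.Complexity.TimeBoundsProofs
import HarnessLib

/-!
# Space-bounded iteration of a SPACE-bounded machine; space of a sequential composite

Companion of `SpaceLoop.lean` (the loop machine `SpaceLoop.loopTM M` of a bundled multi-stack
machine `M` with Boolean input/output: on input `x` it runs `M` on `0x`, then repeatedly on `1w`
for the previous output `w`, until an output raises the flag `1`, whose second symbol is the
answer; `SpaceLoop.mem_PSPACE`: if `M` is a polynomial-TIME machine and the orbit words have
polynomial length then the decided language is in `PSPACE`). There the work space of the embedded
runs of `M` is derived from their running time (`SpaceLoop.stkLen_le_of_iterate`: a `T`-step run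
touches `O(T)` cells, Arora–Barak 2009, Thm. 4.2). This file records the same theorems for an
iterated machine that is only known to run in bounded SPACE — the shape needed when one round of
a polynomial-space algorithm itself re-runs a polynomial-space decider (e.g. `NP^PSPACE ⊆ PSPACE`,
Homer–Selman 2011, proof of Prop. 7.5; `∃ᵖ·PSPACE ⊆ PSPACE`, `P^PSPACE ⊆ PSPACE`):

* `SpaceLoop.SpaceRuns M eIn eOut Φ R`: on every word `u` the machine `M` runs from
  `initList` to `haltList` with output `Φ u`, through configurations of total stack length
  `≤ R |u|` (a `RunsVia` statement, `SpaceLoop.RunsVia`);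
* `SpaceLoop.good_trajectory_of_space`, `SpaceLoop.decidesInSpace_of_space`,
  `SpaceLoop.mem_PSPACE_of_space`: the loop machine of such an `M` decides, in work space
  `A + R A` (`A = |x| + s |x| + 2`), every language whose membership is the answer of the first
  flagged orbit word, provided the orbit words up to the flag have length `≤ s |x|`; with `R`, `s`
  polynomially bounded the language is in `PSPACE` (Arora–Barak 2009, §4.1: "space can be
  reused"; the proofs are those of `SpaceLoop.good_trajectory` / `decidesInSpace_of_bound_until_flag`
  / `mem_PSPACE_of_bound_until_flag` with the time-derived stack bound replaced by the hypothesis);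
* `SpaceLoop.RunsVia.map` (transport of a run-through-a-predicate along a step simulation),
  `SpaceLoop.runsVia_stkLen_of_reachesIn` (a time-`T` run is a space-`|u| + #stacks·D·T` run);
* `TM2Comp.stkLen_cfg₁`, `TM2Comp.stkLen_cfg₂`, `TM2Comp.runsVia_stkLen_compTM`: the sequential
  composite `TM2Comp.compTM M₁ M₂ e` (`TimeBoundsProofs.lean`) runs from `initList` to `haltList`
  through configurations of total stack length `≤ B` when both halves do (the second machine reads
  the first machine's output stack in place, so no space is added).

## References

* S. Arora, B. Barak, *Computational Complexity: A Modern Approach*, CUP 2009, Def. 4.1 (work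
  space), Thm. 4.2 (`DTIME(S) ⊆ SPACE(S)`), §4.1 (reuse of space), §1.3 (composition of
  machines). [AroraBarak2009]
* S. Homer, A. L. Selman, *Computability and Complexity Theory*, 2nd ed., Springer 2011,
  Thm. 5.10 / Cor. 5.7 (`NTIME(T) ⊆ DSPACE(T)`, `NP ⊆ PSPACE`: re-running a machine in the space
  of one computation) and proof of Prop. 7.5 (`NP^PSPACE = PSPACE`). [HomerSelman2011]
-/

namespace Literature.Computability.Complexity

namespace SpaceLoop

open Turing StateTransition Function TM2Comp

/-! ### Transport of runs through a predicate -/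

section Map

variable {C C' : Type} {f : C → Option C} {g : C' → Option C'}

/-- **Transport of a run through a predicate along a step simulation**: if `τ` commutes with
single steps and carries `P` into `P'`, then a run of `f` inside `P` is carried to a run of `g`
inside `P'` (same number of steps). [folklore] -/
theorem RunsVia.map (τ : C → C') (H : ∀ c d, f c = some d → g (τ c) = some (τ d))
    {P : C → Prop} {P' : C' → Prop} (hP : ∀ c, P c → P' (τ c)) {a b : C}
    (h : RunsVia f P a b) : RunsVia g P' (τ a) (τ b) := by
  obtain ⟨n, e, hall⟩ := h
  refine ⟨n, iterate_bind_map f g τ H n a b e, fun i hi c' hc' => ?_⟩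
  obtain ⟨d, hd⟩ := exists_iterate_of_le e hi
  have h' := iterate_bind_map f g τ H i a d hd
  rw [h'] at hc'
  obtain rfl := Option.some.inj hc'
  exact hP d (hall i hi d hd)

end Map

section Bundled

variable (M : FinTM2) (eIn : M.Γ M.k₀ ≃ Bool) (eOut : M.Γ M.k₁ ≃ Bool)

/-! ### Space-bounded runs of the iterated machine -/

/-- `SpaceRuns M eIn eOut Φ R`: on every input word `u` (written through `eIn.symm`) the machine
`M` runs from its initial configuration to the halting configuration with output `Φ u` (written
through `eOut.symm`, in Mathlib's `haltList` normal form), and every configuration of the run has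
total stack length `≤ R |u|`. [cite: AroraBarak2009, Def. 4.1 (space-bounded computation)] -/
def SpaceRuns (Φ : List Bool → List Bool) (R : ℕ → ℕ) : Prop :=
  ∀ u : List Bool, RunsVia M.step (fun c => stkLen M c.stk ≤ R u.length)
    (initList M (u.map eIn.symm)) (haltList M ((Φ u).map eOut.symm))

/-- **A time-bounded run is a space-bounded run**: a run of `n` steps from a configuration `c`
passes only through configurations of total stack length `≤ stkLen c + #stacks · D · n`
(`stkLen_le_of_iterate`). [cite: AroraBarak2009, Thm. 4.2 (a time-T computation touches O(T) cells)] -/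
theorem runsVia_stkLen_of_iterate {n : ℕ} {c d : M.Cfg}
    (h : (flip bind M.step)^[n] (some c) = some d) :
    RunsVia M.step (fun a => stkLen M a.stk ≤ stkLen M c.stk + nStk M * machinePushBound M * n) c d := by
  refine ⟨n, h, fun i hi a ha => ?_⟩
  exact (stkLen_le_of_iterate M ha).trans (Nat.add_le_add_left (Nat.mul_le_mul_left _ hi) _)

/-- A machine computing `Φ` within the monotone time bound `T` has `SpaceRuns` with
`R n = n + #stacks · D · T n`. [cite: AroraBarak2009, Thm. 4.2 (DTIME(T) ⊆ SPACE(T))] -/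
theorem spaceRuns_of_outputsWithin {Mx : TM2ComputableAux Bool Bool} {Φ : List Bool → List Bool}
    {T : ℕ → ℕ} (hF : ∀ u, Mx.OutputsWithin u (Φ u) (T u.length)) :
    SpaceRuns Mx.tm Mx.inputAlphabet Mx.outputAlphabet Φ
      (fun n => n + nStk Mx.tm * machinePushBound Mx.tm * T n) := by
  intro u
  obtain ⟨n, hn, hrun⟩ := TM2Iter.reachesIn_of_outputsWithin Mx (hF u)
  refine (runsVia_stkLen_of_iterate Mx.tm hrun).mono fun a ha => ?_
  rw [stkLen_initList, List.length_map] at ha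
  exact ha.trans (Nat.add_le_add_left (Nat.mul_le_mul_left _ hn) _)

/-! ### The loop machine of a space-bounded machine -/

variable {F : List Bool → List Bool} {R : ℕ → ℕ}

/-- **The full trajectory of the loop machine, space-bounded iterated machine.** As
`good_trajectory`, with the hypothesis that `M` computes `F` through configurations of total
stack length `≤ R |u|` (`SpaceRuns`, `R` monotone) in place of a time bound: from its initial
configuration on `x` the loop machine halts with the answer `a` of the first flagged orbit word
`o_N = 1 a w` on `OUT`, through configurations of work space `≤ A + R A` satisfying the read-only
input invariant, where `A` bounds `|x| + 1` and all `|o_k| + 1`, `k ≤ N`.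
[cite: AroraBarak2009, §4.1 (reusing space across iterations)] -/
theorem good_trajectory_of_space (hR : Monotone R) (hF : SpaceRuns M eIn eOut F R)
    (x : List Bool) (N : ℕ) (a : Bool) (w : List Bool)
    (hN : orbit F x N = true :: a :: w) (hlt : ∀ k < N, ∃ w', orbit F x k = false :: w')
    (A : ℕ) (hxA : x.length + 1 ≤ A) (hoA : ∀ k ≤ N, (orbit F x k).length + 1 ≤ A) :
    RunsVia (C := LCfg M) (loopTM M eIn eOut).step (Good M (A + R A) x)
      (cfg M (some (Sum.inr Ctrl.load)) M.initialState (botStk M) x [] [] [])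
      (cfg M none M.initialState (update (botStk M) M.k₁ (w.map eOut.symm)) [] x.reverse [] [a]) := by
  set B := A + R A with hB
  have hAB : A ≤ B := Nat.le_add_right _ _
  have hfedA : ∀ k ≤ N, (fed F x k).length ≤ A := by
    intro k hk
    cases k with
    | zero => simpa using hxA
    | succ k => simpa using hoA k (by omega)
  -- embedded runs of `M` stay good
  have hgoodM : ∀ k ≤ N, ∀ d : M.Cfg, stkLen M d.stk ≤ R (fed F x k).length →
      Good M B x (cfgM d x.reverse) := by
    intro k hk d hd
    exact good_cfgM M (hd.trans ((hR (hfedA k hk)).trans (Nat.le_add_left _ _)))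
  -- phase `load`
  have h0 := load_run M eIn eOut (Good M B x) M.initialState (botStk M) [] [] [] x
    (fun i₁ i₂ h => good_cfg M (by simp; have := congrArg List.length h; simp at this; omega) (by simp [h]))
    (good_cfg M (by simp; omega) (by simp))
  -- phase `feed false`
  have hstart_eq : cfgM (initList M ((fed F x 0).map eIn.symm)) x.reverse =
      cfg M (some (Sum.inl M.main)) M.initialState
        (update (botStk M) M.k₀ (eIn.symm false ::
          ((x.reverse ++ []).reverse.map eIn.symm ++ botStk M M.k₀))) [] (x.reverse ++ []) [] [] := by
    rw [cfgM_initList]; simp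
  have hrun0 := hF (fed F x 0)
  have h1 := feed_run M eIn eOut (Good M B x) M.initialState false [] (x.reverse ++ []) [] (x.reverse ++ [])
    (botStk M)
    (fun t₁ t₂ h => good_cfg M
      (by have := congrArg List.length h; simp at this ⊢; omega) (by simp))
    (by
      rw [← hstart_eq]
      refine hgoodM 0 (Nat.zero_le _) _ ?_
      simpa using hrun0.first)
  rw [← hstart_eq] at h1
  -- the rounds
  have claim : ∀ k ≤ N, RunsVia (C := LCfg M) (loopTM M eIn eOut).step (Good M B x)
      (cfg M (some (Sum.inr Ctrl.load)) M.initialState (botStk M) x [] [] [])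
      (cfgM (initList M ((fed F x k).map eIn.symm)) x.reverse) := by
    intro k
    induction k with
    | zero => intro _; exact h0.trans h1
    | succ k ih =>
      intro hk
      obtain ⟨w', hw'⟩ := hlt k (by omega)
      obtain ⟨n, hrun, hsp⟩ := hF (fed F x k)
      rw [show F (fed F x k) = false :: w' from (orbit_eq F x k).symm.trans hw'] at hrun
      have hoAk := hoA k (by omega)
      rw [hw'] at hoAk
      simp only [List.length_cons] at hoAk
      have hr := round_continue M eIn eOut (Good M B x) x.reverse (fed F x k) w' hrun
        (fun j hj d hd => hgoodM k (by omega) d (hsp j hj d hd))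
        (fun L₁ L₂ h => good_cfg M
          (by have := congrArg List.length h; simp at this ⊢; omega) (by simp))
        (fun t₁ t₂ h => good_cfg M
          (by have := congrArg List.length h; simp at this ⊢; omega) (by simp))
        (by
          have hfed : fed F x (k + 1) = true :: false :: w' := by rw [fed_succ, hw']
          rw [← hfed]
          refine hgoodM (k + 1) hk _ ?_
          simpa using (hF (fed F x (k + 1))).first)
      have hfed : fed F x (k + 1) = true :: false :: w' := by rw [fed_succ, hw']
      rw [hfed]
      exact (ih (by omega)).trans hr
  -- the last round
  obtain ⟨n, hrun, hsp⟩ := hF (fed F x N)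
  rw [show F (fed F x N) = true :: a :: w from (orbit_eq F x N).symm.trans hN] at hrun
  have hoAN := hoA N le_rfl
  rw [hN] at hoAN
  simp only [List.length_cons] at hoAN
  have hr := round_halt M eIn eOut (Good M B x) x.reverse (fed F x N) w a hrun
    (fun j hj d hd => hgoodM N le_rfl d (hsp j hj d hd))
    (good_mk M (by simp; omega) (by simp))
    (good_cfg M (by simp; omega) (by simp))
  exact (claim N le_rfl).trans hr

/-- **The loop machine of a space-bounded machine decides in bounded space** (bound on the orbit
required only up to the flag). If `M` computes `F` through configurations of total stack length
`≤ R |u|` (`R` monotone), every orbit word of `x` before and at the first flag has length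
`≤ s |x|`, and the orbit of every `x` raises the flag with the answer `[x ∈ L]`, then the space
machine of the loop decides `L` in work space `A + R A`, `A = |x| + s |x| + 2`, respecting the
read-only input. [cite: AroraBarak2009, §4.1 (space-bounded computation; reuse of space)] -/
theorem decidesInSpace_of_space (hR : Monotone R) (hF : SpaceRuns M eIn eOut F R)
    (L : Language Bool) (s : ℕ → ℕ)
    (hs : ∀ x k, (∀ j < k, ∃ w', orbit F x j = false :: w') → (orbit F x k).length ≤ s x.length)
    (hhalt : ∀ x, ∃ N w, orbit F x N = true :: L.boolIndicator x :: w ∧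
      ∀ k < N, ∃ w', orbit F x k = false :: w') :
    DecidesInSpace (spaceMachine M eIn eOut) L
      (fun x => (x.length + s x.length + 2) + R (x.length + s x.length + 2)) := by
  -- the trajectory of every input
  have traj : ∀ x, ∃ w : List Bool, RunsVia (C := LCfg M) (loopTM M eIn eOut).step
      (Good M ((x.length + s x.length + 2) + R (x.length + s x.length + 2)) x)
      ((spaceMachine M eIn eOut).init x)
      (cfg M none M.initialState (update (botStk M) M.k₁ (w.map eOut.symm))
        [] x.reverse [] [L.boolIndicator x]) := by
    intro x
    obtain ⟨N, w, hN, hlt⟩ := hhalt x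
    refine ⟨w, ?_⟩
    rw [spaceMachine_init]
    exact good_trajectory_of_space M eIn eOut hR hF x N (L.boolIndicator x) w hN hlt
      (x.length + s x.length + 2) (by omega)
      (fun k hk => by have := hs x k (fun j hj => hlt j (Nat.lt_of_lt_of_le hj hk)); omega)
  have hnone : ∀ (x w : List Bool), (loopTM M eIn eOut).step
      (cfg M none M.initialState (update (botStk M) M.k₁ (w.map eOut.symm))
        [] x.reverse [] [L.boolIndicator x]) = none := fun x w => rfl
  refine ⟨fun x c hc => ?_, fun x => ⟨?_, fun c hc => ?_⟩⟩
  · obtain ⟨w, hw⟩ := traj x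
    have hg := (hw.forall_reaches (hnone x w) c hc).2
    have e : ∀ l : List Bool, List.map (⇑(Equiv.refl Bool)) l = l := fun l => List.map_id'' (fun _ => rfl) l
    show (List.map (⇑(Equiv.refl Bool)) (c.stk (Sum.inr Aux.LEFT))).reverse ++
      List.map (⇑(Equiv.refl Bool)) (c.stk (Sum.inr Aux.IN)) = x
    rw [e, e]
    exact hg
  · obtain ⟨w, hw⟩ := traj x
    exact ⟨_, hw.mem_eval (hnone x w), rfl⟩
  · obtain ⟨w, hw⟩ := traj x
    have hg := hw.forall_reaches (hnone x w) c hc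
    rw [workSpace_eq_ws]
    exact hg.1

/-- **Space-bounded iteration of a space-bounded machine decides `PSPACE` languages.** If `M`
computes `F` through configurations of total stack length `≤ R |u|` with `R` monotone and
polynomially bounded, the orbit words of every input up to the first flag have polynomial length,
and the first flagged word answers `[x ∈ L]`, then `L ∈ PSPACE`: the loop machine re-runs `M` in
place, so its work space is that of ONE run of `M` on a word of polynomial length.
[cite: HomerSelman2011, Thm. 5.10 and Cor. 5.7 (re-running a machine in the space of one computation); proof of Prop. 7.5]
[cite: AroraBarak2009, §4.1 (space is reused)] -/
theorem mem_PSPACE_of_space {L : Language Bool} (hR : Monotone R) (r : Polynomial ℕ)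
    (hRr : ∀ n, R n ≤ r.eval n) (hF : SpaceRuns M eIn eOut F R) (s : Polynomial ℕ)
    (hs : ∀ x k, (∀ j < k, ∃ w', orbit F x j = false :: w') → (orbit F x k).length ≤ s.eval x.length)
    (hhalt : ∀ x, ∃ N w, orbit F x N = true :: L.boolIndicator x :: w ∧
      ∀ k < N, ∃ w', orbit F x k = false :: w') :
    L ∈ PSPACE := by
  have hD := decidesInSpace_of_space M eIn eOut hR hF L (fun n => s.eval n) hs hhalt
  set q : Polynomial ℕ := (Polynomial.X + s + 2) + r.comp (Polynomial.X + s + 2) with hq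
  have hq_eval : ∀ n, q.eval n = (n + s.eval n + 2) + r.eval (n + s.eval n + 2) := by
    intro n; simp [hq, Polynomial.eval_comp]
  obtain ⟨c, k, hck⟩ := exists_eval_le_mul_pow_add q
  refine Set.mem_iUnion.2 ⟨k, c, spaceMachine M eIn eOut, hD.1, fun x => ⟨(hD.2 x).1, ?_⟩⟩
  refine ((hD.2 x).2).mono ?_
  dsimp only
  refine le_trans ?_ (hck x.length)
  rw [hq_eval]
  exact Nat.add_le_add_left (hRr _) _

end Bundled

end SpaceLoop

/-! ### Space of the sequential composite `compTM` -/

namespace TM2Comp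

open Turing StateTransition Function SpaceLoop

variable (M₁ M₂ : FinTM2) (e : M₁.Γ M₁.k₁ ≃ M₂.Γ M₂.k₀)

/-- Total stack length of the composite machine, split along the two summands. [folklore] -/
theorem stkLen_compTM (S : ∀ j, List ((compTM M₁ M₂ e).Γ j)) :
    stkLen (compTM M₁ M₂ e) S =
      stkLen M₁ (fun k => S (Sum.inl k)) + stkLen M₂ (fun k => S (Sum.inr k)) := by
  letI := M₁.kFin; letI := M₂.kFin
  change (∑ j : M₁.K ⊕ M₂.K, (S j).length) =
    (∑ k : M₁.K, (S (Sum.inl k)).length) + ∑ k : M₂.K, (S (Sum.inr k)).length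
  exact Fintype.sum_sum_type _

/-- While the first machine runs, the composite machine uses exactly its space. [folklore] -/
theorem stkLen_cfg₁ (c : M₁.Cfg) :
    stkLen (compTM M₁ M₂ e) (cfg₁ (G₂ := M₂.Γ) M₂.main M₂.initialState c).stk = stkLen M₁ c.stk := by
  rw [stkLen_compTM]
  simp [cfg₁, stk₁, stkLen]

/-- While the second machine runs, the composite machine uses exactly its space (the input stack
of the second machine lives, with the same length, on the output stack of the first). [folklore] -/
theorem stkLen_cfg₂ (c : M₂.Cfg) :
    stkLen (compTM M₁ M₂ e) (cfg₂ (Λ₁ := M₁.Λ) M₁.k₁ M₂.k₀ e M₁.initialState c).stk = stkLen M₂ c.stk := by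
  rw [stkLen_compTM]
  have h1 : stkLen M₁ (fun k => (cfg₂ (Λ₁ := M₁.Λ) M₁.k₁ M₂.k₀ e M₁.initialState c).stk (Sum.inl k)) =
      (c.stk M₂.k₀).length := by
    simp only [cfg₂, stk₂]
    rw [show (fun k => update (fun j => ([] : List (M₁.Γ j))) M₁.k₁ ((c.stk M₂.k₀).map e.symm) k) =
      update (botStk M₁) M₁.k₁ ((c.stk M₂.k₀).map e.symm) from rfl, stkLen_update_bot, List.length_map]
  have h2 : stkLen M₂ (fun k => (cfg₂ (Λ₁ := M₁.Λ) M₁.k₁ M₂.k₀ e M₁.initialState c).stk (Sum.inr k)) +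
      (c.stk M₂.k₀).length = stkLen M₂ c.stk := by
    simp only [cfg₂, stk₂]
    have := stkLen_update M₂ c.stk M₂.k₀ []
    simpa using this
  omega

/-- **Space of a sequential composite.** If `M₁` runs from its initial configuration on `s` to
the halting configuration with output `s'` through configurations of total stack length `≤ B`,
and `M₂` runs from its initial configuration on `s'` (read through `e`) to the halting
configuration with output `s''` likewise, then the composite `compTM M₁ M₂ e` runs from its
initial configuration on `s` to its halting configuration with output `s''` through
configurations of total stack length `≤ B`. [cite: AroraBarak2009, §1.3 (machines running other machines), §4.1] -/
theorem runsVia_stkLen_compTM {B : ℕ} {s : List (M₁.Γ M₁.k₀)} {s' : List (M₁.Γ M₁.k₁)}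
    {s'' : List (M₂.Γ M₂.k₁)}
    (h₁ : RunsVia M₁.step (fun c => stkLen M₁ c.stk ≤ B) (initList M₁ s) (haltList M₁ s'))
    (h₂ : RunsVia M₂.step (fun c => stkLen M₂ c.stk ≤ B) (initList M₂ (s'.map e)) (haltList M₂ s'')) :
    RunsVia (compTM M₁ M₂ e).step (fun c => stkLen (compTM M₁ M₂ e) c.stk ≤ B)
      (initList (compTM M₁ M₂ e) s)
      (haltList (compTM M₁ M₂ e) (s''.map (redirect M₁.k₁ M₂.k₀ e M₂.k₁).2.symm)) := by
  have H₁ := h₁.map (cfg₁ (G₂ := M₂.Γ) M₂.main M₂.initialState) (compTM_step_cfg₁ M₁ M₂ e)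
    (P' := fun c => stkLen (compTM M₁ M₂ e) c.stk ≤ B) (fun c hc => by rwa [stkLen_cfg₁])
  have H₂ := h₂.map (cfg₂ (Λ₁ := M₁.Λ) M₁.k₁ M₂.k₀ e M₁.initialState) (compTM_step_cfg₂ M₁ M₂ e)
    (P' := fun c => stkLen (compTM M₁ M₂ e) c.stk ≤ B) (fun c hc => by rwa [stkLen_cfg₂])
  rw [cfg₁_initList, cfg₁_haltList] at H₁
  rw [cfg₂_haltList] at H₂
  exact H₁.trans H₂

end TM2Comp

end Literature.Computability.Complexity
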